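import Literature.NumberTheory.Transcendental.KaehlerHodgeConjProofs
import Literature.NumberTheory.Transcendental.KaehlerHodgeDelLaplacianFact
import HarnessLib

/-!
# `Δ_d = 2Δ_∂̄` implies `Δ_∂̄ = Δ_∂` (reality of `Δ_d` and conjugation): glue for `dolbeaultLaplacian_eq_delLaplacian`

Theorems-only companion of `Literature/NumberTheory/Transcendental/KaehlerHodge.lean` (C12), of
`KaehlerHodgeConjProofs.lean` (the unconditional conjugation plumbing `Δ_∂ ᾱ = \overline{Δ_∂̄ α}`,
`Δ_d ᾱ = \overline{Δ_d α}`) and of `KaehlerHodgeDelLaplacianFact.lean` (the corrected statement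
`dolbeaultLaplacian_eq_delLaplacian_of_isManifold_complex` of the Kähler identity `Δ_∂̄ = Δ_∂`).

Voisin (2002), §6.1.2, Thm. 6.7 (p. 141) states `Δ_∂ = Δ_∂̄ = ½Δ_d` on a Kähler manifold and proves
`Δ_d = 2Δ_∂` from the first-order Kähler identities (Prop. 6.5), adding "the other equality is proved
similarly". The tree keeps the two halves as two named facts of `KaehlerHodge.lean`,
`cHodgeLaplacian_eq_two_smul_dolbeaultLaplacian` (`Δ_d = 2Δ_∂̄`) and `dolbeaultLaplacian_eq_delLaplacian`
(`Δ_∂̄ = Δ_∂`), with corrected closed statements `…_of_isManifold_complex` (holomorphic atlas as a binder).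
This file records that **the second half is a formal corollary of the first**, by an argument that uses
no Kähler identity, no holomorphic atlas and no property of the metric: `Δ_d` is a real operator
(`cHodgeLaplacian_conj`: `Δ_d ᾱ = \overline{Δ_d α}`) and conjugation exchanges the two Dolbeault
Laplacians (`delLaplacian_conj`: `Δ_∂ ᾱ = \overline{Δ_∂̄ α}`, Voisin (2002), §6.1.1, p. 141:
"`∂̄*α = \overline{∂*(ᾱ)}`"; Huybrechts (2005), §3.2, Remarks 3.2.7 (i)), so if `Δ_d β = 2Δ_∂̄ β` holds
for `β = α` and for `β = ᾱ` then
`2Δ_∂ α = 2\overline{Δ_∂̄ ᾱ} = \overline{Δ_d ᾱ} = Δ_d α = 2Δ_∂̄ α`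
(`dolbeaultLaplacian_eq_delLaplacian_of_two_smul`). Consequently

* `dolbeaultLaplacian_eq_delLaplacian_of_cHodgeLaplacian_eq_two_smul` — instance-wise, for every metric
  term `g`, orientation family `o` and degrees `(k, m)`:
  `cHodgeLaplacian_eq_two_smul_dolbeaultLaplacian g o → dolbeaultLaplacian_eq_delLaplacian g o`
  (both read as the parametrised predicates of `KaehlerHodge.lean`);
* `dolbeaultLaplacian_eq_delLaplacian_of_isManifold_complex_of_cHodgeLaplacian_eq_two_smul` — the same
  for the corrected closed statements at a complex manifold: the corrected fact
  `dolbeaultLaplacian_eq_delLaplacian_of_isManifold_complex g o` is discharged the moment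
  `cHodgeLaplacian_eq_two_smul_dolbeaultLaplacian_of_isManifold_complex_holds` (Voisin, Thm. 6.7 via
  Prop. 6.5 — the only deep input, not yet in the tree) lands, so that the Kähler-identity debt of
  `KaehlerHodge.lean` is carried by that one named fact (cf. the reductions of
  `dolbeaultHarmonicForms_conj`, `dolbeaultHarmonicForms_le_charmonicForms`,
  `typeComponent_mem_charmonicForms` and `charmonicForms_eq_iSup_dolbeaultHarmonicForms` to the same fact).

The converse implication (`Δ_∂̄ = Δ_∂ ⇒ Δ_d = 2Δ_∂̄`) is *not* formal — it needs `d* = ∂* + ∂̄*` and the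
vanishing of the cross terms `∂∂̄* + ∂̄*∂`, i.e. the Kähler identities again
(`KaehlerIdentities.cHodgeLaplacian_eq_two_smul_dolbeaultLaplacian`, `KaehlerHodgeLaplacianDProofs.lean`) —
and is not attempted. No definition and no named fact is introduced.

## References

* C. Voisin, *Hodge Theory and Complex Algebraic Geometry I*, Cambridge Studies in Advanced
  Mathematics 76 (2002), §6.1.1 (p. 141), §6.1.2 Thm. 6.7 (p. 141). [cite: Voisin2002, §6.1.2 Thm. 6.7]
* D. Huybrechts, *Complex Geometry. An Introduction*, Universitext (2005), Prop. 3.1.12 (iii); §3.2,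
  Remarks 3.2.7 (i). [cite: Huybrechts2005, Prop. 3.1.12 (iii)]
-/

noncomputable section

open scoped Manifold ContDiff ComplexConjugate
open Bundle Module
open Literature.Geometry.Kaehler (MForm IsSmoothForm)

namespace Literature.NumberTheory.Transcendental

variable {E : Type*} [NormedAddCommGroup E] [NormedSpace ℂ E]
  {M : Type*} [TopologicalSpace M] [ChartedSpace E M] {k m : ℕ}

/-! ### The algebraic step, for any metric -/

section Riemannian

variable [FiniteDimensional ℂ E] {n : ℕ} [Fact (finrank ℝ E = n)]
  [RiemannianBundle (fun x : M ↦ TangentSpace 𝓘(ℝ, E) x)]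
  (o : (x : M) → Orientation ℝ (TangentSpace 𝓘(ℝ, E) x) (Fin n))

/-- **`Δ_d = 2Δ_∂̄` on `α` and `ᾱ` forces `Δ_∂̄ α = Δ_∂ α`** (any metric, any atlas, any form; degrees
`k + m = n`): `2Δ_∂ α = 2\overline{Δ_∂̄ ᾱ} = \overline{Δ_d ᾱ} = Δ_d α = 2Δ_∂̄ α`, by `delLaplacian_conj`
(`Δ_∂ ᾱ = \overline{Δ_∂̄ α}`) and `cHodgeLaplacian_conj` (`Δ_d` is real). This is the content of "the
other equality is proved similarly" in Voisin (2002), proof of Thm. 6.7, p. 141, once `Δ_d = 2Δ_∂̄` is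
known. [cite: Voisin2002, §6.1.2 Thm. 6.7] -/
theorem dolbeaultLaplacian_eq_delLaplacian_of_two_smul (h : k + m = n) {α : MForm 𝓘(ℝ, E) M ℂ k}
    (hα : cHodgeLaplacian o k m h α = (2 : ℂ) • dolbeaultLaplacian o k m h α)
    (hα' : cHodgeLaplacian o k m h α.conj = (2 : ℂ) • dolbeaultLaplacian o k m h α.conj) :
    dolbeaultLaplacian o k m h α = delLaplacian o k m h α := by
  have h1 : delLaplacian o k m h α = (dolbeaultLaplacian o k m h α.conj).conj := by
    rw [← delLaplacian_conj o h α.conj, Literature.Geometry.Kaehler.MForm.conj_conj]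
  have h2 : (2 : ℂ) • dolbeaultLaplacian o k m h α.conj =
      (2 : ℂ) • (dolbeaultLaplacian o k m h α).conj := by
    rw [← hα', cHodgeLaplacian_conj, hα, Literature.Geometry.Kaehler.MForm.conj_smul, map_ofNat]
  have h3 : dolbeaultLaplacian o k m h α.conj = (dolbeaultLaplacian o k m h α).conj :=
    smul_right_injective (MForm 𝓘(ℝ, E) M ℂ k) (two_ne_zero' ℂ) h2
  rw [h1, h3, Literature.Geometry.Kaehler.MForm.conj_conj]

end Riemannian

/-! ### The named facts: `Δ_d = 2Δ_∂̄` implies `Δ_∂̄ = Δ_∂` -/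

section Facts

variable [FiniteDimensional ℂ E] {n : ℕ} [Fact (finrank ℝ E = n)] [IsManifold 𝓘(ℝ, E) ∞ M]
  (g : ContMDiffRiemannianMetric 𝓘(ℝ, E) ∞ E (fun x : M ↦ TangentSpace 𝓘(ℝ, E) x))
  (o : (x : M) → Orientation ℝ (TangentSpace 𝓘(ℝ, E) x) (Fin n))

/-- **`cHodgeLaplacian_eq_two_smul_dolbeaultLaplacian g o → dolbeaultLaplacian_eq_delLaplacian g o`**,
instance-wise (the parametrised predicates of `KaehlerHodge.lean`, same metric term `g`, orientation family
`o` and degrees `(k, m)`; no holomorphic atlas, no use of the Kähler hypothesis beyond passing it on): if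
`Δ_d = 2Δ_∂̄` on the smooth complex `k`-forms of `(M, g)` then `Δ_∂̄ = Δ_∂` on them, by
`dolbeaultLaplacian_eq_delLaplacian_of_two_smul` applied to `α` and `ᾱ` (`isSmoothForm_conj`).
Voisin (2002), §6.1.2, Thm. 6.7 ("the other equality is proved similarly").
[cite: Voisin2002, §6.1.2 Thm. 6.7] -/
theorem dolbeaultLaplacian_eq_delLaplacian_of_cHodgeLaplacian_eq_two_smul
    (h2 : cHodgeLaplacian_eq_two_smul_dolbeaultLaplacian (k := k) (m := m) g o) :
    dolbeaultLaplacian_eq_delLaplacian (k := k) (m := m) g o := by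
  intro hg h α hα
  letI : RiemannianBundle (fun x : M ↦ TangentSpace 𝓘(ℝ, E) x) := ⟨g.toRiemannianMetric⟩
  intro ho
  exact dolbeaultLaplacian_eq_delLaplacian_of_two_smul o h (h2 hg h hα ho)
    (h2 hg h (isSmoothForm_conj hα) ho)

/-- **The corrected fact `Δ_∂̄ = Δ_∂` from the corrected fact `Δ_d = 2Δ_∂̄`** (complex manifold,
holomorphic atlas `[IsManifold 𝓘(ℂ, E) ω M]` a binder of both `def`s):
`cHodgeLaplacian_eq_two_smul_dolbeaultLaplacian_of_isManifold_complex g o →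
dolbeaultLaplacian_eq_delLaplacian_of_isManifold_complex g o`. Hence
`dolbeaultLaplacian_eq_delLaplacian_of_isManifold_complex_holds` is one line once
`cHodgeLaplacian_eq_two_smul_dolbeaultLaplacian_of_isManifold_complex_holds` (Voisin (2002), Thm. 6.7 via
Prop. 6.5) lands; no separate input is needed for `Δ_∂̄ = Δ_∂`. [cite: Voisin2002, §6.1.2 Thm. 6.7] -/
theorem dolbeaultLaplacian_eq_delLaplacian_of_isManifold_complex_of_cHodgeLaplacian_eq_two_smul
    [IsManifold 𝓘(ℂ, E) ω M]
    (h2 : cHodgeLaplacian_eq_two_smul_dolbeaultLaplacian_of_isManifold_complex (k := k) (m := m) g o) :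
    dolbeaultLaplacian_eq_delLaplacian_of_isManifold_complex (k := k) (m := m) g o :=
  dolbeaultLaplacian_eq_delLaplacian_of_cHodgeLaplacian_eq_two_smul g o h2

end Facts

end Literature.NumberTheory.Transcendental
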